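import Mathlib
import Literature.NumberTheory.LFunctions.Zhang2022.Section11LamCSums
import HarnessLib

/-!
# Zhang (2022) §7/§11: the weights of the window bound for `S_j` — `Σ_r |μ(r)|Λc(r)2^{ω(r)}/(rφ(r))`
# and the harmonic sum over a window

Topic `Literature/NumberTheory/LFunctions/Zhang2022` (Landau–Siegel audit tree; verdict-neutral).
Y. Zhang, *Discrete mean estimates and the Landau–Siegel zero*, arXiv:2211.02515v1 (2022)
[Zhang2022LandauSiegel], §7 p. 33 (the arithmetic sums `S_j(𝐚₁,𝐚₂) = Σ_dΣ_r |μ(r)|λ₀ⱼ(dr)/(drφ(r))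
(Σ_m a₁(drm)m^{−(1−β_j)})(Σ_n a₂(drn)ξ₀ⱼ(n;d,r)/n)` of Proposition 7.1) and §11 p. 64 (tex L3299,
"by (11.3), (8.25) and (8.26)": the window mean square `Z22:§11.u019`, typed
`Typed.TypedSection11B.Step11u019`, GAP row G-L3t10-1) — **an unrefereed manuscript under
adjudication; nothing here asserts or denies its Theorems 1–2.** ZHANG-L discharge lane, WP11.

The TRUE-SIZE route for the window `S_j` (zl-w11-p2; `Section11XiZeroTrueSize`:
`Σ_{n≤X}|ξ₀ⱼ(n;d,r)|/n ≤ K·2^{ω(r)}·𝓛⁹`) bounds the `n`-sum of `S_j` globally and keeps only the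
`m`-window; it then needs the two elementary estimates PROVED here (theorems only):

* `sum_moebius_LamC_two_pow_div_le` — **`Σ_{r≤X} |μ(r)|Λc(r)2^{ω(r)}/(rφ(r)) ≤ e^{28 + 14S₀}`**
  for every `X` (`ω(r) = #primeFactors r`; the multiplicative `r ↦ |μ(r)|Λc(r)2^{ω(r)}/φ(r)` has
  value `2(1 + 12/p)/(p−1) ≤ 28/p` at `p` and vanishes at higher prime powers; Hall–Tenenbaum (0.4)
  via the tree's `XiZeroMajorant.sum_div_le_gen`) — the twin of `sum_moebius_LamC_div_le`
  (`Section11LamCSums`, zl-libB-p6) with the extra factor `2^{ω(r)}`;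
* `sum_inv_window_le` — for reals `0 < x`, `0 < η₋ ≤ η₊`, `0 < Y`:
  **`Σ_{m<N, xη₋<Ym<xη₊} 1/m ≤ (η₊ − η₋)/η₋ + [Y < xη₊]·Y/(xη₋)`** (the integers of the window
  `(xη₋/Y, xη₊/Y)` number at most `x(η₊−η₋)/Y + 1`, each with `1/m < Y/(xη₋)`);
* `sum_LamC_div_mul_window_le` — **`Σ_{d<N} Λc(d)/d·Σ_{m<N, xη₋<drm<xη₊} 1/m
  ≤ ((η₊−η₋)/η₋)·e^{16+7S₀}·log N + e^{12+6S₀}·η₊/η₋`** for `N ≥ 2`, `r ≥ 1`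
  (`Σ_{d≤N}Λc(d)/d ≤ e^{16+7S₀} log N`, `sum_LamC_div_le`; `Σ_{d≤W}Λc(d) ≤ e^{12+6S₀}W`,
  `sum_LamC_le`).

No new objects (the weight and `ω(r)` are written out). No statement about the manuscript's
Theorems 1–2 or about Landau–Siegel zeros is made or implied.

## References

* Y. Zhang, arXiv:2211.02515v1 (2022), §7 Prop. 7.1 p. 33; §11 p. 64.
  [cite: Zhang2022LandauSiegel, §7 Prop. 7.1 p.33; §11 p.64]
* R. R. Hall, G. Tenenbaum, *Divisors* (CUP 1988), (0.4). [cite: HallTenenbaum1988, (0.4)]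
-/

noncomputable section

open Finset Real ArithmeticFunction

namespace Literature.NumberTheory.LFunctions.Zhang2022.XiZeroMajorant

/-! ### `Σ_{r≤X} |μ(r)|Λc(r)2^{ω(r)}/(rφ(r)) ≤ C` -/

/-- `ω(mn) = ω(m) + ω(n)` for coprime `m, n ≠ 0` (disjoint prime factors). [folklore] -/
private theorem card_primeFactors_mul_of_coprime {m n : ℕ} (hm : m ≠ 0) (hn : n ≠ 0)
    (hmn : Nat.Coprime m n) :
    (m * n).primeFactors.card = m.primeFactors.card + n.primeFactors.card := by
  rw [Nat.primeFactors_mul hm hn, card_union_of_disjoint hmn.disjoint_primeFactors]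

/-- At a prime: `|μ(p)|Λc(p)2^{ω(p)}/φ(p) = 2(1 + 12/p)/(p − 1) ≤ 28/p`.
[cite: Zhang2022LandauSiegel, §7 p.33] -/
theorem natAbs_moebius_mul_LamC_two_pow_div_totient_prime_le {p : ℕ} (hp : p.Prime) :
    ((ArithmeticFunction.moebius p).natAbs : ℝ) * LamC p * (2 : ℝ) ^ p.primeFactors.card /
        (Nat.totient p : ℝ) ≤ 28 / (p : ℝ) := by
  have hp2 : (2 : ℝ) ≤ p := by exact_mod_cast hp.two_le
  have hppos : (0 : ℝ) < p := by linarith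
  have h14 := natAbs_moebius_mul_LamC_div_totient_prime_le hp
  have hφpos : (0 : ℝ) < (Nat.totient p : ℝ) := by
    exact_mod_cast Nat.totient_pos.mpr hp.pos
  rw [hp.primeFactors, card_singleton, pow_one]
  have e : ((ArithmeticFunction.moebius p).natAbs : ℝ) * LamC p * 2 / (Nat.totient p : ℝ) =
      2 * (((ArithmeticFunction.moebius p).natAbs : ℝ) * LamC p / (Nat.totient p : ℝ)) := by
    ring
  rw [e]
  calc 2 * (((ArithmeticFunction.moebius p).natAbs : ℝ) * LamC p / (Nat.totient p : ℝ))
      ≤ 2 * (14 / (p : ℝ)) := by linarith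
    _ = 28 / (p : ℝ) := by ring

/-- At prime powers: `|μ(p^ν)|Λc(p^ν)2^{ω(p^ν)}/φ(p^ν) ≤ 14` (`1`, `≤ 28/p ≤ 14`, or `0` for `ν ≥ 2`).
[cite: Zhang2022LandauSiegel, §7 p.33] -/
theorem natAbs_moebius_mul_LamC_two_pow_div_totient_prime_pow_le {p : ℕ} (hp : p.Prime) (ν : ℕ) :
    ((ArithmeticFunction.moebius (p ^ ν)).natAbs : ℝ) * LamC (p ^ ν) *
        (2 : ℝ) ^ (p ^ ν).primeFactors.card / (Nat.totient (p ^ ν) : ℝ) ≤ 14 := by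
  have hp2 : (2 : ℝ) ≤ p := by exact_mod_cast hp.two_le
  rcases Nat.lt_or_ge ν 2 with hν | hν
  · interval_cases ν
    · rw [pow_zero, isMultiplicative_LamC.map_one, isMultiplicative_moebius.map_one]; simp
    · rw [pow_one]
      refine (natAbs_moebius_mul_LamC_two_pow_div_totient_prime_le hp).trans ?_
      rw [div_le_iff₀ (by linarith)]; linarith
  · rw [moebius_apply_prime_pow hp (by omega), if_neg (by omega)]
    simp

/-- **`Σ_{r≤X} |μ(r)|Λc(r)2^{ω(r)}/(rφ(r)) ≤ e^{28 + 14S₀}`** for every `X` (`ω(r) = #primeFactors r`,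
`S₀ = LogEulerProduct.tailConst 0`): a convergent Euler product, the summand at `p` being `≤ 28/p²`;
Hall–Tenenbaum (0.4) via the tree's `sum_div_le_gen` applied to the multiplicative
`r ↦ |μ(r)|Λc(r)2^{ω(r)}/φ(r)`. [cite: Zhang2022LandauSiegel, §7 Prop. 7.1 p.33; §11 p.64] -/
theorem sum_moebius_LamC_two_pow_div_le (X : ℕ) :
    ∑ r ∈ Icc 1 X, ((ArithmeticFunction.moebius r).natAbs : ℝ) * LamC r *
        (2 : ℝ) ^ r.primeFactors.card / ((r : ℝ) * (Nat.totient r : ℝ)) ≤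
      Real.exp (28 + 14 * LogEulerProduct.tailConst 0) := by
  set E : ℝ := Real.exp (28 + 14 * LogEulerProduct.tailConst 0) with hE
  have hE1 : 1 ≤ E := by
    rw [hE]; exact Real.one_le_exp (by linarith [LogEulerProduct.tailConst_nonneg 0])
  -- the multiplicative function `f(r) = |μ(r)|Λc(r)2^{ω(r)}/φ(r)`
  set f : ℕ → ℝ := fun r =>
    ((ArithmeticFunction.moebius r).natAbs : ℝ) * LamC r * (2 : ℝ) ^ r.primeFactors.card /
      (Nat.totient r : ℝ) with hf
  have hf0 : ∀ r, 0 ≤ f r := fun r =>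
    div_nonneg (mul_nonneg (mul_nonneg (Nat.cast_nonneg _) (LamC_nonneg r)) (by positivity))
      (Nat.cast_nonneg _)
  have hf1 : f 1 = 1 := by
    rw [hf]; dsimp only
    rw [isMultiplicative_LamC.map_one, isMultiplicative_moebius.map_one]; simp
  have hfmul : ∀ m n : ℕ, Nat.Coprime m n → f (m * n) = f m * f n := by
    intro m n hmn
    rw [hf]; dsimp only
    rcases eq_or_ne m 0 with rfl | hm
    · simp [LamC]
    rcases eq_or_ne n 0 with rfl | hn
    · simp [LamC]
    rw [isMultiplicative_moebius.map_mul_of_coprime hmn, Int.natAbs_mul, Nat.cast_mul,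
      isMultiplicative_LamC.map_mul_of_coprime hmn, Nat.totient_mul hmn, Nat.cast_mul,
      card_primeFactors_mul_of_coprime hm hn hmn, pow_add]
    rw [div_mul_div_comm]
    ring
  have hfpow : ∀ p ν : ℕ, p.Prime → f (p ^ ν) ≤ 14 := fun p ν hp =>
    natAbs_moebius_mul_LamC_two_pow_div_totient_prime_pow_le hp ν
  have hfsum : ∀ p : ℕ, p.Prime → Summable fun ν : ℕ => f (p ^ ν) / (p : ℝ) ^ ν := by
    intro p hp
    have hp2 : (2 : ℝ) ≤ p := by exact_mod_cast hp.two_le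
    refine Summable.of_nonneg_of_le (fun ν => div_nonneg (hf0 _) (by positivity))
      (fun ν => ?_) ((summable_geometric_of_lt_one (by norm_num : (0 : ℝ) ≤ 1 / 2)
        (by norm_num)).mul_left 14)
    have hppos : (0 : ℝ) < (p : ℝ) ^ ν := by positivity
    rw [div_le_iff₀ hppos]
    have h1 : (1 : ℝ) ≤ (1 / 2 : ℝ) ^ ν * (p : ℝ) ^ ν := by
      rw [← mul_pow]; exact one_le_pow₀ (by linarith)
    calc f (p ^ ν) ≤ 14 := hfpow p ν hp
      _ ≤ 14 * ((1 / 2 : ℝ) ^ ν * (p : ℝ) ^ ν) := le_mul_of_one_le_right (by norm_num) h1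
      _ = 14 * (1 / 2 : ℝ) ^ ν * (p : ℝ) ^ ν := by ring
  -- rewrite the summand as `f r / r`
  have hterm : ∀ r ∈ Icc 1 X, ((ArithmeticFunction.moebius r).natAbs : ℝ) * LamC r *
      (2 : ℝ) ^ r.primeFactors.card / ((r : ℝ) * (Nat.totient r : ℝ)) = f r / r := by
    intro r _
    rw [hf]; dsimp only
    rw [div_div, mul_comm (Nat.totient r : ℝ)]
  rw [sum_congr rfl hterm]
  rcases Nat.lt_or_ge X 2 with hX | hX
  · interval_cases X
    · simp; linarith
    · rw [show Icc 1 1 = {1} by rfl, sum_singleton, hf1]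
      simpa using hE1
  · have h := sum_div_le_gen (f := f) hf1 hfmul hf0 (a := 0) (d := 0) (K := 0) (M := 28)
      (C₅ := 14) le_rfl (by norm_num) (by norm_num) hX hfsum
      (fun p hp _ => by
        have := natAbs_moebius_mul_LamC_two_pow_div_totient_prime_le hp
        push_cast; rw [hf]; dsimp only; linarith)
      (fun p ν hp _ => by rw [pow_zero, mul_one]; exact hfpow p ν hp)
    simpa using h

/-- **Packaged**: `∃ C > 0, ∀ X, Σ_{r≤X} |μ(r)|Λc(r)2^{ω(r)}/(rφ(r)) ≤ C`.
[cite: Zhang2022LandauSiegel, §7 Prop. 7.1 p.33; §11 p.64] -/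
theorem exists_sum_moebius_LamC_two_pow_div_le : ∃ C : ℝ, 0 < C ∧ ∀ X : ℕ,
    ∑ r ∈ Icc 1 X, ((ArithmeticFunction.moebius r).natAbs : ℝ) * LamC r *
        (2 : ℝ) ^ r.primeFactors.card / ((r : ℝ) * (Nat.totient r : ℝ)) ≤ C :=
  ⟨_, Real.exp_pos _, sum_moebius_LamC_two_pow_div_le⟩

/-! ### The harmonic sum over a window -/

/-- **The harmonic sum over a window.** For reals `0 < x`, `0 < η₋ ≤ η₊`, `0 < Y` and any `N`:
`Σ_{m<N : xη₋ < Ym < xη₊} 1/m ≤ (η₊ − η₋)/η₋ + [Y < xη₊]·Y/(xη₋)` — the integers `m` of the window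
`(xη₋/Y, xη₊/Y)` number at most `x(η₊−η₋)/Y + 1`, each has `1/m < Y/(xη₋)`, and the window
contains an integer `m ≥ 1` only if `Y < xη₊`. [cite: Zhang2022LandauSiegel, §11 p.64] -/
theorem sum_inv_window_le {x ηm ηp Y : ℝ} (hx : 0 < x) (hηm : 0 < ηm) (hη : ηm ≤ ηp) (hY : 0 < Y)
    (N : ℕ) :
    ∑ m ∈ (Ico 1 N).filter (fun m : ℕ => x * ηm < Y * m ∧ Y * m < x * ηp), (1 : ℝ) / m ≤
      (ηp - ηm) / ηm + (if Y < x * ηp then Y / (x * ηm) else 0) := by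
  set S := (Ico 1 N).filter (fun m : ℕ => x * ηm < Y * m ∧ Y * m < x * ηp) with hS
  have hxη : 0 < x * ηm := mul_pos hx hηm
  have hfirst : 0 ≤ (ηp - ηm) / ηm := div_nonneg (by linarith) hηm.le
  by_cases hne : S = ∅
  · rw [hne, sum_empty]
    have : 0 ≤ (if Y < x * ηp then Y / (x * ηm) else 0) := by
      split_ifs
      · positivity
      · exact le_rfl
    linarith
  -- the window contains some `m ≥ 1`, so `Y < x ηp`
  obtain ⟨m₀, hm₀⟩ := nonempty_iff_ne_empty.mpr hne
  have hm₀' := (mem_filter.mp hm₀)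
  have hm₀1 : (1 : ℝ) ≤ m₀ := by exact_mod_cast (mem_Ico.mp hm₀'.1).1
  have hYlt : Y < x * ηp := by
    have h2 := hm₀'.2.2
    nlinarith
  rw [if_pos hYlt]
  -- each term is `< Y/(x ηm)`
  have hterm : ∀ m ∈ S, (1 : ℝ) / m ≤ Y / (x * ηm) := by
    intro m hm
    have hm' := (mem_filter.mp hm)
    have hm1 : (0 : ℝ) < m := by exact_mod_cast (mem_Ico.mp hm'.1).1
    rw [div_le_div_iff₀ hm1 hxη]
    linarith [hm'.2.1]
  -- the number of terms
  set A : ℝ := x * ηm / Y with hA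
  set B : ℝ := x * ηp / Y with hB
  have hA0 : 0 ≤ A := by positivity
  have hsub : S ⊆ Ioc ⌊A⌋₊ ⌊B⌋₊ := by
    intro m hm
    have hm' := (mem_filter.mp hm)
    rw [mem_Ioc]
    have hmA : A < m := by rw [hA, div_lt_iff₀ hY]; linarith [hm'.2.1]
    have hmB : (m : ℝ) < B := by rw [hB, lt_div_iff₀ hY]; linarith [hm'.2.2]
    constructor
    · exact (Nat.floor_lt hA0).mpr hmA
    · -- `m < B` and `m` integer give `m ≤ ⌊B⌋`
      by_contra hcon
      have hcon' : ⌊B⌋₊ + 1 ≤ m := by omega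
      have : (⌊B⌋₊ : ℝ) + 1 ≤ m := by exact_mod_cast hcon'
      have hBlt := Nat.lt_floor_add_one B
      linarith
  have hcard : (S.card : ℝ) ≤ B - A + 1 := by
    have h1 : S.card ≤ ⌊B⌋₊ - ⌊A⌋₊ := by
      have := card_le_card hsub; rwa [Nat.card_Ioc] at this
    have hAB : A ≤ B := by
      rw [hA, hB]; exact div_le_div_of_nonneg_right (by nlinarith) hY.le
    have hfl : ⌊A⌋₊ ≤ ⌊B⌋₊ := Nat.floor_le_floor hAB
    have h2 : (S.card : ℝ) ≤ (⌊B⌋₊ : ℝ) - (⌊A⌋₊ : ℝ) := by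
      have : ((⌊B⌋₊ - ⌊A⌋₊ : ℕ) : ℝ) = (⌊B⌋₊ : ℝ) - (⌊A⌋₊ : ℝ) := by rw [Nat.cast_sub hfl]
      rw [← this]; exact_mod_cast h1
    have h3 : (⌊B⌋₊ : ℝ) ≤ B := Nat.floor_le (hA0.trans hAB)
    have h4 : A < (⌊A⌋₊ : ℝ) + 1 := Nat.lt_floor_add_one A
    linarith
  calc ∑ m ∈ S, (1 : ℝ) / m ≤ ∑ m ∈ S, Y / (x * ηm) := sum_le_sum hterm
    _ = S.card * (Y / (x * ηm)) := by rw [sum_const, nsmul_eq_mul]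
    _ ≤ (B - A + 1) * (Y / (x * ηm)) := mul_le_mul_of_nonneg_right hcard (by positivity)
    _ = (ηp - ηm) / ηm + Y / (x * ηm) := by
        rw [hA, hB]; field_simp

/-- **The `d`-sum of the window route.** For `N ≥ 2`, `r ≥ 1`, reals `0 < x`, `0 < η₋ ≤ η₊`:
`Σ_{d<N} Λc(d)/d · Σ_{m<N : xη₋<drm<xη₊} 1/m ≤ ((η₊−η₋)/η₋)·e^{16+7S₀}·log N + e^{12+6S₀}·η₊/η₋`
(the first term from `sum_inv_window_le` and `Σ_{d≤N}Λc(d)/d ≤ e^{16+7S₀}log N`, the second from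
`Σ_{d<xη₊/r} Λc(d)·dr/(xη₋) ≤ (r/(xη₋))·e^{12+6S₀}·(xη₊/r)`).
[cite: Zhang2022LandauSiegel, §7 Prop. 7.1 p.33; §11 p.64] -/
theorem sum_LamC_div_mul_window_le {N : ℕ} (hN : 2 ≤ N) {r : ℕ} (hr : r ≠ 0) {x ηm ηp : ℝ}
    (hx : 0 < x) (hηm : 0 < ηm) (hη : ηm ≤ ηp) :
    ∑ d ∈ Ico 1 N, LamC d / d *
        ∑ m ∈ (Ico 1 N).filter (fun m : ℕ => x * ηm < ((d * r : ℕ) : ℝ) * m ∧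
          ((d * r : ℕ) : ℝ) * m < x * ηp), (1 : ℝ) / m ≤
      (ηp - ηm) / ηm * (Real.exp (16 + 7 * LogEulerProduct.tailConst 0) * Real.log N) +
        Real.exp (12 + 6 * LogEulerProduct.tailConst 0) * (ηp / ηm) := by
  set E₁ : ℝ := Real.exp (16 + 7 * LogEulerProduct.tailConst 0) with hE₁
  set E₂ : ℝ := Real.exp (12 + 6 * LogEulerProduct.tailConst 0) with hE₂
  have hS0 := LogEulerProduct.tailConst_nonneg 0
  have hrpos : (0 : ℝ) < r := by exact_mod_cast Nat.pos_of_ne_zero hr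
  have hηp : 0 < ηp := lt_of_lt_of_le hηm hη
  have hxη : 0 < x * ηm := mul_pos hx hηm
  have hθ : 0 ≤ (ηp - ηm) / ηm := div_nonneg (by linarith) hηm.le
  -- termwise: `Λc(d)/d·H(dr) ≤ Λc(d)/d·(ηp−ηm)/ηm + [dr < xηp]·Λc(d)·r/(xηm)`
  have hterm : ∀ d ∈ Ico 1 N, LamC d / d *
      ∑ m ∈ (Ico 1 N).filter (fun m : ℕ => x * ηm < ((d * r : ℕ) : ℝ) * m ∧
        ((d * r : ℕ) : ℝ) * m < x * ηp), (1 : ℝ) / m ≤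
      LamC d / d * ((ηp - ηm) / ηm) +
        (if d ∈ Icc 1 ⌊x * ηp / r⌋₊ then LamC d * (r / (x * ηm)) else 0) := by
    intro d hd
    have hd1 : 1 ≤ d := (mem_Ico.mp hd).1
    have hdpos : (0 : ℝ) < d := by exact_mod_cast hd1
    have hY : (0 : ℝ) < ((d * r : ℕ) : ℝ) := by push_cast; positivity
    have hw := sum_inv_window_le hx hηm hη hY N
    have hΛd : 0 ≤ LamC d / d := div_nonneg (LamC_nonneg d) hdpos.le
    refine (mul_le_mul_of_nonneg_left hw hΛd).trans ?_
    rw [mul_add]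
    refine add_le_add le_rfl ?_
    by_cases h1 : ((d * r : ℕ) : ℝ) < x * ηp
    · have h2 : d ∈ Icc 1 ⌊x * ηp / r⌋₊ := by
        rw [mem_Icc]
        refine ⟨hd1, Nat.le_floor ?_⟩
        rw [le_div_iff₀ hrpos]
        push_cast at h1
        linarith
      rw [if_pos h1, if_pos h2]
      push_cast
      have e : LamC d / d * ((d : ℝ) * r / (x * ηm)) = LamC d * (r / (x * ηm)) := by
        field_simp
      rw [e]
    · rw [if_neg h1, mul_zero]
      split_ifs
      · exact mul_nonneg (LamC_nonneg d) (by positivity)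
      · exact le_rfl
  refine (sum_le_sum hterm).trans ?_
  rw [sum_add_distrib, ← sum_mul, ← sum_filter]
  -- first sum: `Σ_{d<N} Λc(d)/d ≤ E₁ log N`
  have hsubN : Ico 1 N ⊆ Icc 1 N := fun n hn => by
    rw [mem_Ico] at hn; rw [mem_Icc]; omega
  have hΛ : ∑ d ∈ Ico 1 N, LamC d / d ≤ E₁ * Real.log N := by
    have h := sum_LamC_div_le hN
    simp only [Nat.cast_one, mul_one, zero_mul, add_zero, pow_one] at h
    have e : (4 : ℝ) + 12 + 7 * LogEulerProduct.tailConst 0 = 16 + 7 * LogEulerProduct.tailConst 0 := by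
      ring
    rw [e] at h
    exact (sum_le_sum_of_subset_of_nonneg hsubN fun d _ _ =>
      div_nonneg (LamC_nonneg d) (Nat.cast_nonneg d)).trans h
  -- second sum: `Σ_{d ≤ ⌊xηp/r⌋} Λc(d)·r/(xηm) ≤ E₂·ηp/ηm`
  have hW := sum_LamC_le ⌊x * ηp / r⌋₊
  have hflo : (⌊x * ηp / r⌋₊ : ℝ) ≤ x * ηp / r := Nat.floor_le (by positivity)
  have h2 : ∑ d ∈ (Ico 1 N).filter (fun d => d ∈ Icc 1 ⌊x * ηp / r⌋₊), LamC d * (r / (x * ηm)) ≤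
      E₂ * (ηp / ηm) := by
    rw [← sum_mul]
    have hsub : (Ico 1 N).filter (fun d => d ∈ Icc 1 ⌊x * ηp / r⌋₊) ⊆ Icc 1 ⌊x * ηp / r⌋₊ :=
      fun d hd => (mem_filter.mp hd).2
    have hs : ∑ d ∈ (Ico 1 N).filter (fun d => d ∈ Icc 1 ⌊x * ηp / r⌋₊), LamC d ≤
        E₂ * ⌊x * ηp / r⌋₊ :=
      (sum_le_sum_of_subset_of_nonneg hsub fun d _ _ => LamC_nonneg d).trans hW
    calc (∑ d ∈ (Ico 1 N).filter (fun d => d ∈ Icc 1 ⌊x * ηp / r⌋₊), LamC d) * (r / (x * ηm))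
        ≤ (E₂ * ⌊x * ηp / r⌋₊) * (r / (x * ηm)) :=
          mul_le_mul_of_nonneg_right hs (by positivity)
      _ ≤ (E₂ * (x * ηp / r)) * (r / (x * ηm)) := by gcongr
      _ = E₂ * (ηp / ηm) := by field_simp
  have h1 : (∑ d ∈ Ico 1 N, LamC d / d) * ((ηp - ηm) / ηm) ≤ (E₁ * Real.log N) * ((ηp - ηm) / ηm) :=
    mul_le_mul_of_nonneg_right hΛ hθ
  calc (∑ d ∈ Ico 1 N, LamC d / d) * ((ηp - ηm) / ηm) +
        ∑ d ∈ (Ico 1 N).filter (fun d => d ∈ Icc 1 ⌊x * ηp / r⌋₊), LamC d * (r / (x * ηm))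
      ≤ (E₁ * Real.log N) * ((ηp - ηm) / ηm) + E₂ * (ηp / ηm) := add_le_add h1 h2
    _ = (ηp - ηm) / ηm * (E₁ * Real.log N) + E₂ * (ηp / ηm) := by ring

end Literature.NumberTheory.LFunctions.Zhang2022.XiZeroMajorant

end
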